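import Mathlib
import Literature.Analysis.FluidPDE.Tao2016AveragedNS.BoundedEternalSolutions
import HarnessLib

/-!
# Tail-energy tools for route `WakeRatchet` (supports of items stmt-NavierStokesRegularity-21809
  `TailEnvelopeFinite` and stmt-NavierStokesRegularity-21810 `RatchetStarvation`)

Elementary real analysis about the physical shell energies `E_k(σ) = physEnergy ε₀ W k σ =
Λ^{-2k} e^{2σ} ‖W_k(σ)‖²` of a family `W : ℤ → ℝ → ℝ^m` in the renormalised variables of Tao's
cascade (Tao 2016 §4 / §6.4), under a UNIFORM amplitude bound `‖W_k(σ)‖ ≤ C`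
(`TaoCascade.UniformBound`):

* `inv_bigLam_zpow_add_sq`, `inv_bigLam_sq_lt_one` — the weights split geometrically,
  `Λ^{-2(n+k)} = Λ^{-2n} (Λ^{-2})^k` with ratio `Λ^{-2} ∈ [0,1)` (`Λ = bigLam ε₀ = (1+ε₀)^{5/2} > 1`);
* `physEnergy_le_geom` — `E_{n+k}(σ) ≤ Λ^{-2n} e^{2σ} C² (Λ^{-2})^k`;
* `summable_tail` — every tail series `Σ_{k ≥ 0} E_{n+k}(σ)` converges;
* `physEnergy_le_tail` — `E_n(σ) ≤ Σ_{k ≥ 0} E_{n+k}(σ)`;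
* `tsum_le_geom` — `Σ_{k ≥ 0} E_{n+k}(σ) ≤ Λ^{-2n} e^{2σ} C² / (1 − Λ^{-2})`.

HONEST FRAMING: bookkeeping about families indexed like solutions of Tao-type MODEL lattice ODEs;
nothing here is a statement about the Navier–Stokes equations.
-/

noncomputable section

set_option linter.dupNamespace false

namespace Summit.NavierStokesRegularity.NavierStokesRegularity.Theorems

namespace WakeRatchetTail

open Filter Topology
open Literature.Analysis.FluidPDE Literature.Analysis.FluidPDE.TaoCascade

variable {m : ℕ} {ε₀ : ℝ} {W : ℤ → ℝ → Em m}

/-- The physical weights split geometrically: `Λ^{-2(n+k)} = Λ^{-2n} · (Λ^{-2})^k`.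
[cite: Tao2016AveragedNS, §4 (Λ = (1+ε₀)^{5/2}, the weights of Lemma 4.1); elementary] -/
theorem inv_bigLam_zpow_add_sq (hε : 0 < ε₀) (n : ℤ) (k : ℕ) :
    (bigLam ε₀ ^ (n + (k : ℤ)))⁻¹ ^ 2 = (bigLam ε₀ ^ n)⁻¹ ^ 2 * ((bigLam ε₀)⁻¹ ^ 2) ^ k := by
  have hb : 0 < bigLam ε₀ := bigLam_pos (by linarith)
  rw [zpow_add₀ hb.ne', zpow_natCast, mul_inv, mul_pow, ← inv_pow, ← pow_mul, mul_comm k 2,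
    pow_mul]

/-- `Λ^{-2} ∈ [0, 1)` for `ε₀ > 0`.
[cite: Tao2016AveragedNS, §4 (Λ = (1+ε₀)^{5/2} > 1); elementary] -/
theorem inv_bigLam_sq_lt_one (hε : 0 < ε₀) :
    0 ≤ (bigLam ε₀)⁻¹ ^ 2 ∧ (bigLam ε₀)⁻¹ ^ 2 < 1 := by
  have hb1 : 1 < bigLam ε₀ := Real.one_lt_rpow (by linarith) (by norm_num)
  have hi0 : 0 ≤ (bigLam ε₀)⁻¹ := inv_nonneg.2 (zero_le_one.trans hb1.le)
  have hi1 : (bigLam ε₀)⁻¹ < 1 := inv_lt_one_of_one_lt₀ hb1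
  exact ⟨pow_nonneg hi0 2, pow_lt_one₀ hi0 hi1 two_ne_zero⟩

/-- Geometric domination of the shell energies above shell `n` under a uniform amplitude bound:
`E_{n+k}(σ) ≤ Λ^{-2n} e^{2σ} C² · (Λ^{-2})^k`.
[cite: Tao2016AveragedNS, §4 Lemma 4.1 (4.10) in the self-similar variables of §6.4; elementary] -/
theorem physEnergy_le_geom (hε : 0 < ε₀) {C : ℝ} (hC : ∀ (k : ℤ) (σ : ℝ), ‖W k σ‖ ≤ C)
    (n : ℤ) (σ : ℝ) (k : ℕ) :
    physEnergy ε₀ W (n + k) σ ≤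
      (bigLam ε₀ ^ n)⁻¹ ^ 2 * (Real.exp (2 * σ) * C ^ 2) * ((bigLam ε₀)⁻¹ ^ 2) ^ k := by
  have e := inv_bigLam_zpow_add_sq hε n k
  have h2 : ‖W (n + k) σ‖ ^ 2 ≤ C ^ 2 := pow_le_pow_left₀ (norm_nonneg _) (hC _ _) 2
  unfold physEnergy
  rw [e]
  have h0 : 0 ≤ (bigLam ε₀ ^ n)⁻¹ ^ 2 * ((bigLam ε₀)⁻¹ ^ 2) ^ k * Real.exp (2 * σ) := by
    positivity
  calc (bigLam ε₀ ^ n)⁻¹ ^ 2 * ((bigLam ε₀)⁻¹ ^ 2) ^ k * (Real.exp (2 * σ) * ‖W (n + k) σ‖ ^ 2)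
      = (bigLam ε₀ ^ n)⁻¹ ^ 2 * ((bigLam ε₀)⁻¹ ^ 2) ^ k * Real.exp (2 * σ) * ‖W (n + k) σ‖ ^ 2 := by
        ring
    _ ≤ (bigLam ε₀ ^ n)⁻¹ ^ 2 * ((bigLam ε₀)⁻¹ ^ 2) ^ k * Real.exp (2 * σ) * C ^ 2 :=
        mul_le_mul_of_nonneg_left h2 h0
    _ = (bigLam ε₀ ^ n)⁻¹ ^ 2 * (Real.exp (2 * σ) * C ^ 2) * ((bigLam ε₀)⁻¹ ^ 2) ^ k := by ring

/-- Under `UniformBound`, every tail series `Σ_{k ≥ 0} E_{n+k}(σ)` converges (comparison with a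
geometric series of ratio `Λ^{-2} < 1`).
[cite: Tao2016AveragedNS, §4 Lemma 4.1 (4.10) in the self-similar variables of §6.4; elementary] -/
theorem summable_tail (hε : 0 < ε₀) (hU : UniformBound W) (n : ℤ) (σ : ℝ) :
    Summable (fun k : ℕ => physEnergy ε₀ W (n + k) σ) := by
  obtain ⟨C, hC⟩ := hU
  obtain ⟨hq0, hq1⟩ := inv_bigLam_sq_lt_one hε
  refine Summable.of_nonneg_of_le (fun k => physEnergy_nonneg _ _ _ _)
    (fun k => physEnergy_le_geom hε hC n σ k) ?_
  exact (summable_geometric_of_lt_one hq0 hq1).mul_left _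

/-- A shell energy is at most the tail energy it heads: `E_n(σ) ≤ Σ_{k ≥ 0} E_{n+k}(σ)`.
[cite: Tao2016AveragedNS, §4 Lemma 4.1 (4.10) in the self-similar variables of §6.4; elementary] -/
theorem physEnergy_le_tail (hε : 0 < ε₀) (hU : UniformBound W) (n : ℤ) (σ : ℝ) :
    physEnergy ε₀ W n σ ≤ ∑' k : ℕ, physEnergy ε₀ W (n + k) σ := by
  have h := (summable_tail hε hU n σ).le_tsum 0 (fun k _ => physEnergy_nonneg _ _ _ _)
  simpa only [Nat.cast_zero, add_zero] using h

/-- The geometric tail bound under a uniform amplitude bound `‖W_k(σ)‖ ≤ C`: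
`Σ_{k ≥ 0} E_{n+k}(σ) ≤ Λ^{-2n} e^{2σ} C² / (1 − Λ^{-2})`.
[cite: Tao2016AveragedNS, §4 Lemma 4.1 (4.10) in the self-similar variables of §6.4; elementary] -/
theorem tsum_le_geom (hε : 0 < ε₀) {C : ℝ} (hC : ∀ (k : ℤ) (σ : ℝ), ‖W k σ‖ ≤ C)
    (n : ℤ) (σ : ℝ) :
    ∑' k : ℕ, physEnergy ε₀ W (n + k) σ ≤
      (bigLam ε₀ ^ n)⁻¹ ^ 2 * (Real.exp (2 * σ) * C ^ 2) * (1 - (bigLam ε₀)⁻¹ ^ 2)⁻¹ := by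
  obtain ⟨hq0, hq1⟩ := inv_bigLam_sq_lt_one hε
  have hgeom := summable_geometric_of_lt_one hq0 hq1
  calc ∑' k : ℕ, physEnergy ε₀ W (n + k) σ
      ≤ ∑' k : ℕ, (bigLam ε₀ ^ n)⁻¹ ^ 2 * (Real.exp (2 * σ) * C ^ 2) * ((bigLam ε₀)⁻¹ ^ 2) ^ k :=
        Summable.tsum_le_tsum (fun k => physEnergy_le_geom hε hC n σ k)
          (summable_tail hε ⟨C, hC⟩ n σ) (hgeom.mul_left _)
    _ = (bigLam ε₀ ^ n)⁻¹ ^ 2 * (Real.exp (2 * σ) * C ^ 2) * (1 - (bigLam ε₀)⁻¹ ^ 2)⁻¹ := by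
        rw [tsum_mul_left, tsum_geometric_of_lt_one hq0 hq1]

end WakeRatchetTail

end Summit.NavierStokesRegularity.NavierStokesRegularity.Theorems

end
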